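import Literature.Computability.Complexity.AffineHashing
import Mathlib.Algebra.BigOperators.Fin
import Mathlib.Logic.Equiv.Fin.Basic
import Mathlib.Data.Vector.Basic
import HarnessLib

/-!
# Bit layouts: explicit codes of finite data as bit strings, with their slices

Trunk T-CPLX-CORE, generic. A `BitLayout α N` is an explicit bijection `α ≃ (Fin N → Bool)`
built from Mathlib's arithmetic equivalences (`finSumFinEquiv`, `finProdFinEquiv`,
`finSigmaFinEquiv`, `finFunctionFinEquiv`, `Equiv.vectorEquivFin`), so that a uniformly random
bit string of length `N` IS a uniformly random element of `α` and, at the same time, every field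
of `α` sits in a KNOWN slice of the string (`prod_apply_castAdd`, `prod_apply_natAdd`,
`pi_apply`) — which is what a Turing-machine verifier reading its private coins by position needs.
Combinators: `vector`, `zmod2`, `zvec` (vectors over `𝔽₂`), `finPow` (`Fin 2ᵏ` in binary), `prod`,
`pi` (blocks indexed by `Fin k`), `sigmaPi` (blocks of varying lengths), `matrix`, `hash` (affine
hash functions `(A, b)` of `AffineHashing.lean`), `ofEquiv`. Written for the agreement step of the
App. D campaign (`Literature.Barriers.PneNP.AkaviaEtAl2006_complMemAM`: the protocol's coins as the
machine's coin string) but independent of it. Mathlib + `AffineHashing.lean`; all proved, [folklore].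

## References

* [AroraBarakCC2009] S. Arora, B. Barak, *Computational Complexity: A Modern Approach*, CUP 2009,
  §1.2 (representing objects as strings).
-/

namespace Literature.Computability.Complexity

open Finset

/-- **An explicit code of `α` by bit strings of length `N`.** [folklore] -/
structure BitLayout (α : Type*) (N : ℕ) where
  /-- the code -/
  equiv : α ≃ (Fin N → Bool)

namespace BitLayout

variable {α β : Type*} {N N₁ N₂ : ℕ}

/-- Transport along a bijection. [folklore] -/
def ofEquiv (e : β ≃ α) (L : BitLayout α N) : BitLayout β N := ⟨e.trans L.equiv⟩

/-- A bit string codes itself. [folklore] -/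
def bits (N : ℕ) : BitLayout (Fin N → Bool) N := ⟨Equiv.refl _⟩

/-- Bit vectors. [folklore] -/
def vector (k : ℕ) : BitLayout (List.Vector Bool k) k := ⟨Equiv.vectorEquivFin Bool k⟩

/-- `𝔽₂` as one bit (`1 ↦ true`). [folklore] -/
def zmod2Equiv : ZMod 2 ≃ Bool := finTwoEquiv

/-- Vectors over `𝔽₂`. [folklore] -/
def zvec (k : ℕ) : BitLayout (Fin k → ZMod 2) k := ⟨Equiv.arrowCongr (Equiv.refl _) zmod2Equiv⟩

/-- `Fin 2ᵏ` in binary (little-endian digits, `finFunctionFinEquiv`). [folklore] -/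
def finPow (k : ℕ) : BitLayout (Fin (2 ^ k)) k :=
  ⟨finFunctionFinEquiv.symm.trans (Equiv.arrowCongr (Equiv.refl _) finTwoEquiv)⟩

/-- **Concatenation**: the code of a pair is the code of the first component followed by the
code of the second. [folklore] -/
def prod (L₁ : BitLayout α N₁) (L₂ : BitLayout β N₂) : BitLayout (α × β) (N₁ + N₂) :=
  ⟨(Equiv.prodCongr L₁.equiv L₂.equiv).trans
    ((Equiv.sumArrowEquivProdArrow (Fin N₁) (Fin N₂) Bool).symm.trans (Equiv.arrowCongr finSumFinEquiv (Equiv.refl _)))⟩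

/-- The first component occupies the first `N₁` bits. [folklore] -/
@[simp] theorem prod_apply_castAdd (L₁ : BitLayout α N₁) (L₂ : BitLayout β N₂) (p : α × β) (i : Fin N₁) :
    (prod L₁ L₂).equiv p (Fin.castAdd N₂ i) = L₁.equiv p.1 i := by
  simp [prod, Equiv.arrowCongr_apply, Equiv.sumArrowEquivProdArrow]

/-- The second component occupies the last `N₂` bits. [folklore] -/
@[simp] theorem prod_apply_natAdd (L₁ : BitLayout α N₁) (L₂ : BitLayout β N₂) (p : α × β) (j : Fin N₂) :
    (prod L₁ L₂).equiv p (Fin.natAdd N₁ j) = L₂.equiv p.2 j := by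
  simp [prod, Equiv.arrowCongr_apply, Equiv.sumArrowEquivProdArrow]

/-- **Blocks**: a `k`-tuple is coded as `k` consecutive blocks of `N` bits (`finProdFinEquiv`:
block `i`, offset `j` ↦ position `i·N + j`). [folklore] -/
def pi (L : BitLayout α N) (k : ℕ) : BitLayout (Fin k → α) (k * N) :=
  ⟨(Equiv.arrowCongr (Equiv.refl _) L.equiv).trans
    ((Equiv.curry (Fin k) (Fin N) Bool).symm.trans (Equiv.arrowCongr finProdFinEquiv (Equiv.refl _)))⟩

/-- Block `i`, offset `j`. [folklore] -/
@[simp] theorem pi_apply (L : BitLayout α N) (k : ℕ) (g : Fin k → α) (i : Fin k) (j : Fin N) :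
    (pi L k).equiv g (finProdFinEquiv (i, j)) = L.equiv (g i) j := by
  simp [pi, Equiv.arrowCongr_apply, Equiv.curry]

/-- The position of block `i`, offset `j` is `i·N + j`. [folklore] -/
theorem pi_pos (k : ℕ) (i : Fin k) (j : Fin N) : ((finProdFinEquiv (i, j) : Fin (k * N)) : ℕ) = i * N + j := by
  simp [finProdFinEquiv]
  ring_nf

/-- **Blocks of varying lengths**: a dependent tuple `Π i : Fin k, β i` with `β i` coded in `Nf i`
bits is coded as consecutive blocks (`finSigmaFinEquiv`). [folklore] -/
def sigmaPi {k : ℕ} {βf : Fin k → Type*} {Nf : Fin k → ℕ} (L : ∀ i, BitLayout (βf i) (Nf i)) :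
    BitLayout (∀ i, βf i) (∑ i, Nf i) :=
  ⟨(Equiv.piCongrRight fun i => (L i).equiv).trans
    ((Equiv.piCurry fun (i : Fin k) (_ : Fin (Nf i)) => Bool).symm.trans
      (Equiv.arrowCongr finSigmaFinEquiv (Equiv.refl _)))⟩

/-- Block `i`, offset `j` of a dependent tuple. [folklore] -/
@[simp] theorem sigmaPi_apply {k : ℕ} {βf : Fin k → Type*} {Nf : Fin k → ℕ} (L : ∀ i, BitLayout (βf i) (Nf i))
    (g : ∀ i, βf i) (i : Fin k) (j : Fin (Nf i)) :
    (sigmaPi L).equiv g (finSigmaFinEquiv ⟨i, j⟩) = (L i).equiv (g i) j := by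
  simp only [sigmaPi, Equiv.trans_apply, Equiv.arrowCongr_apply, Equiv.coe_refl, Function.comp_apply, id_eq]
  show (fun x : Σ i, Fin (Nf i) => (Equiv.piCurry fun (i : Fin k) (_ : Fin (Nf i)) => Bool).symm
      ((Equiv.piCongrRight fun i => (L i).equiv) g) x) (finSigmaFinEquiv.symm (finSigmaFinEquiv ⟨i, j⟩)) = _
  rw [Equiv.symm_apply_apply]
  simp [Equiv.piCurry, Sigma.uncurry]

/-- Matrices over `𝔽₂`, row by row. [folklore] -/
def matrix (k m : ℕ) : BitLayout (Matrix (Fin k) (Fin m) (ZMod 2)) (k * m) := pi (zvec m) k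

/-- **Affine hash functions** `(A, b) : Hash m k`: the matrix, then the offset. [folklore] -/
def hash (m k : ℕ) : BitLayout (AffineHash.Hash m k) (k * m + k) := prod (matrix k m) (zvec k)

/-- A singleton carries no bits. [folklore] -/
def unique [Unique α] : BitLayout α 0 := ⟨Equiv.ofUnique _ _⟩

/-! ### Decoding: the inverse layouts, componentwise -/

/-- Decoding a transported layout. [folklore] -/
@[simp] theorem ofEquiv_symm_apply (e : β ≃ α) (L : BitLayout α N) (v : Fin N → Bool) :
    (ofEquiv e L).equiv.symm v = e.symm (L.equiv.symm v) := rfl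

/-- Decoding a concatenation: the first component from the first `N₁` bits. [folklore] -/
@[simp] theorem prod_symm_fst (L₁ : BitLayout α N₁) (L₂ : BitLayout β N₂) (v : Fin (N₁ + N₂) → Bool) :
    ((prod L₁ L₂).equiv.symm v).1 = L₁.equiv.symm (fun i => v (Fin.castAdd N₂ i)) := by
  obtain ⟨p, rfl⟩ := (prod L₁ L₂).equiv.surjective v
  simp

/-- Decoding a concatenation: the second component from the last `N₂` bits. [folklore] -/
@[simp] theorem prod_symm_snd (L₁ : BitLayout α N₁) (L₂ : BitLayout β N₂) (v : Fin (N₁ + N₂) → Bool) :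
    ((prod L₁ L₂).equiv.symm v).2 = L₂.equiv.symm (fun j => v (Fin.natAdd N₁ j)) := by
  obtain ⟨p, rfl⟩ := (prod L₁ L₂).equiv.surjective v
  simp

/-- Decoding blocks: component `i` from block `i`. [folklore] -/
@[simp] theorem pi_symm_apply (L : BitLayout α N) (k : ℕ) (v : Fin (k * N) → Bool) (i : Fin k) :
    (pi L k).equiv.symm v i = L.equiv.symm (fun j => v (finProdFinEquiv (i, j))) := by
  obtain ⟨g, rfl⟩ := (pi L k).equiv.surjective v
  simp

/-- Decoding blocks of varying lengths. [folklore] -/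
@[simp] theorem sigmaPi_symm_apply {k : ℕ} {βf : Fin k → Type*} {Nf : Fin k → ℕ} (L : ∀ i, BitLayout (βf i) (Nf i))
    (v : Fin (∑ i, Nf i) → Bool) (i : Fin k) :
    (sigmaPi L).equiv.symm v i = (L i).equiv.symm (fun j => v (finSigmaFinEquiv ⟨i, j⟩)) := by
  obtain ⟨g, rfl⟩ := (sigmaPi L).equiv.surjective v
  simp

/-- Decoding a bit vector: bit `i` is bit `i`. [folklore] -/
@[simp] theorem vector_symm_get (k : ℕ) (v : Fin k → Bool) (i : Fin k) : ((vector k).equiv.symm v).get i = v i := by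
  simp [vector, Equiv.vectorEquivFin]

/-- Decoding a vector over `𝔽₂`. [folklore] -/
@[simp] theorem zvec_symm_apply (k : ℕ) (v : Fin k → Bool) (i : Fin k) : (zvec k).equiv.symm v i = zmod2Equiv.symm (v i) := rfl

/-- Decoding a binary number: the value is `Σ bitᵢ 2^i`. [folklore] -/
theorem finPow_symm_val (k : ℕ) (v : Fin k → Bool) : (((finPow k).equiv.symm v : Fin (2 ^ k)) : ℕ) = ∑ i : Fin k, (v i).toNat * 2 ^ (i : ℕ) := by
  simp only [finPow, Equiv.symm_trans_apply, Equiv.symm_symm, finFunctionFinEquiv_apply]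
  refine Finset.sum_congr rfl fun i _ => ?_
  congr 1
  simp only [Equiv.arrowCongr, Equiv.coe_fn_symm_mk, Function.comp_apply, Equiv.refl_symm, Equiv.coe_refl, id_eq]
  cases v i <;> rfl

/-- **Uniform pull-back**: counting along the code. [folklore] -/
theorem card_filter_eq [Fintype α] (L : BitLayout α N) (P : α → Prop) [DecidablePred P] :
    (univ.filter fun v : Fin N → Bool => P (L.equiv.symm v)).card = (univ.filter P).card := by
  refine card_bij (fun v _ => L.equiv.symm v) (fun v hv => by simpa using hv) (fun a _ b _ h => L.equiv.symm.injective h)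
    (fun a ha => ⟨L.equiv a, by simpa using ha, L.equiv.symm_apply_apply a⟩)

/-- The code witnesses `|α| = 2^N`. [folklore] -/
theorem card_eq [Fintype α] (L : BitLayout α N) : Fintype.card α = 2 ^ N := by
  rw [Fintype.card_congr L.equiv]; simp

end BitLayout

end Literature.Computability.Complexity
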